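import Mathlib.Analysis.SpecialFunctions.Pow.Real
import HarnessLib

/-!
# Drappeau 2017, §5.5: the exponent bookkeeping of (5.24)–(5.25)

Topic `Literature/NumberTheory/Sieve`, part of the formalisation of §5 of S. Drappeau, Proc. London
Math. Soc. (3) 114 (2017) 684–732 = arXiv:1504.05549, p. 21.  The right-hand side of Theorem 2.1
(in the corrected form of Assing–Blomer–Li 2021, Theorem 2.3, whose last term is `D²NR`) evaluated
at the parameters of a blocked piece of `ℛ₁''`
(`𝐪 ≤ x^θ`, `C, D ≤ 2S`, `𝐍 ≤ 38x^δ N Hb`, `R ≤ x^{2δ}N`, `𝐒 ≤ x^δN`, `‖b‖₂² ≤ 100N²·Hb·W²`,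
`Hb = S²Nx^{ε₁}/x + 1`) is `≤ 169632·A·W·N²S²·x^{−8κ}` as soon as
`3.5e + 7.5δ + 10.5κ + ε₁ ≤ ½·min(3η/4, 1/6)` (`e` the total exponent `ε + Bε₀` of Theorem 2.1),
the saving coming from `N ≤ S^{2/3−η}` and `S ≤ x^{1/2+δ}` ("it is crucial that `N ≤ S^{2/3−η}`",
p. 21).  Pure real analysis; everything proved, no definition, no named fact.

## References

* S. Drappeau, Proc. London Math. Soc. (3) 114 (2017) 684–732, arXiv:1504.05549, §5.5 p. 21,
  (5.24)–(5.25). [cite: Drappeau2017, §5.5]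
* E. Assing, V. Blomer, J. Li, Adv. Math. 393 (2021), Theorem 2.3. [cite: AssingBlomerLi2020, Theorem 2.3]
-/

noncomputable section

open Real

namespace Literature.NumberTheory.Sieve

namespace Drappeau2017

/-! ### Bookkeeping with `x ^ a` for `x ≥ 1` -/

/-- `x^a * x^b = x^(a+b)` for `1 ≤ x`. [folklore] -/
theorem xpow_add {x : ℝ} (hx : 1 ≤ x) (a b : ℝ) : x ^ a * x ^ b = x ^ (a + b) :=
  (Real.rpow_add (by linarith) a b).symm

/-- `1 ≤ x^a` for `1 ≤ x`, `0 ≤ a`. [folklore] -/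
theorem one_le_xpow {x a : ℝ} (hx : 1 ≤ x) (ha : 0 ≤ a) : 1 ≤ x ^ a :=
  Real.one_le_rpow hx ha

/-- `S^p ≤ S^r · x^((p − r)/4)` for `p ≤ r`, from `x^{1/4} ≤ S` (`x > 0`). [folklore] -/
theorem Spow_le_mul_xpow {S x p r : ℝ} (hx : 0 < x) (hSx : x ^ (1 / 4 : ℝ) ≤ S) (hpr : p ≤ r) :
    S ^ p ≤ S ^ r * x ^ ((p - r) / 4) := by
  have hS : 0 < S := lt_of_lt_of_le (Real.rpow_pos_of_pos hx _) hSx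
  have h1 : S ^ p = S ^ r * S ^ (p - r) := by
    rw [← Real.rpow_add hS]; ring_nf
  rw [h1]
  gcongr
  calc S ^ (p - r) ≤ (x ^ (1 / 4 : ℝ)) ^ (p - r) :=
        Real.rpow_le_rpow_of_nonpos (Real.rpow_pos_of_pos hx _) hSx (by linarith)
    _ = x ^ ((p - r) / 4) := by rw [← Real.rpow_mul hx.le]; ring_nf

/-! ### Crude bounds for `T` and `T'` -/

section Crude

variable {x δ S N Hb C D Nb R S' : ℝ}

/-- `R S' + Nb ≤ 38 x^{3δ} N (N + Hb)`. [folklore] -/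
theorem crude_RSN (hx : 1 ≤ x) (hδ : 0 ≤ δ) (hN : 0 ≤ N) (hHb : 0 ≤ Hb)
    (hNb : Nb ≤ 38 * x ^ δ * N * Hb) (hR : R ≤ x ^ (2 * δ) * N) (hS'0 : 0 ≤ S')
    (hS' : S' ≤ x ^ δ * N) : R * S' + Nb ≤ 38 * x ^ (3 * δ) * N * (N + Hb) := by
  have hx13 : x ^ δ ≤ x ^ (3 * δ) := Real.rpow_le_rpow_of_exponent_le hx (by linarith)
  have hx3 : x ^ (2 * δ) * x ^ δ = x ^ (3 * δ) := by rw [xpow_add hx]; ring_nf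
  have hxp : 0 ≤ x ^ (3 * δ) := (Real.rpow_pos_of_pos (by linarith) _).le
  have h0 : R * S' ≤ x ^ (3 * δ) * N * N := by
    calc R * S' ≤ (x ^ (2 * δ) * N) * (x ^ δ * N) := by gcongr
      _ = x ^ (3 * δ) * N * N := by rw [← hx3]; ring
  have h1 : Nb ≤ 38 * x ^ (3 * δ) * N * Hb := hNb.trans (by gcongr)
  have h2 : 0 ≤ x ^ (3 * δ) * N * N := by positivity
  nlinarith only [h0, h1, h2]

/-- `C + R D ≤ 4 S x^{2δ} N` (`C, D ≤ 2S`, `x^{2δ} N ≥ 1`). [folklore] -/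
theorem crude_CRD (hx : 1 ≤ x) (hδ : 0 ≤ δ) (hS : 0 ≤ S) (hN : 1 ≤ N) (hC : C ≤ 2 * S)
    (hD0 : 0 ≤ D) (hD : D ≤ 2 * S) (hR : R ≤ x ^ (2 * δ) * N) :
    C + R * D ≤ 4 * S * x ^ (2 * δ) * N := by
  have hx2 : (1 : ℝ) ≤ x ^ (2 * δ) := one_le_xpow hx (by linarith)
  have h1 : R * D ≤ (x ^ (2 * δ) * N) * (2 * S) := by gcongr
  have h2 : (1 : ℝ) ≤ x ^ (2 * δ) * N := by nlinarith only [hx2, hN]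
  nlinarith only [h1, h2, hC, hS]

/-- **`T ≤ 342 x^{6δ} S² N³ (N + Hb)`.** [cite: Drappeau2017, §5.5 p. 21] -/
theorem crude_T (hx : 1 ≤ x) (hδ : 0 ≤ δ) (hS : 1 ≤ S) (hN : 1 ≤ N) (hHb : 1 ≤ Hb)
    (hC0 : 0 ≤ C) (hC : C ≤ 2 * S) (hD0 : 0 ≤ D) (hD : D ≤ 2 * S) (hNb0 : 0 ≤ Nb)
    (hNb : Nb ≤ 38 * x ^ δ * N * Hb) (hR0 : 0 ≤ R) (hR : R ≤ x ^ (2 * δ) * N) (hS'0 : 0 ≤ S')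
    (hS' : S' ≤ x ^ δ * N) :
    C * S' * (R * S' + Nb) * (C + R * D) + S' * Nb * R ≤ 342 * x ^ (6 * δ) * S ^ 2 * N ^ 3 * (N + Hb) := by
  have hS0 : 0 ≤ S := by linarith
  have hN0 : 0 ≤ N := by linarith
  have hHb0 : 0 ≤ Hb := by linarith
  have hx0 : 0 < x := by linarith
  have xp : ∀ a : ℝ, 0 ≤ x ^ a := fun a => (Real.rpow_pos_of_pos hx0 a).le
  have hRSN := crude_RSN hx hδ hN0 hHb0 hNb hR hS'0 hS'
  have hCRD := crude_CRD hx hδ hS0 hN hC hD0 hD hR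
  have hx6 : x ^ δ * x ^ (3 * δ) * x ^ (2 * δ) = x ^ (6 * δ) := by
    rw [xpow_add hx, xpow_add hx]; ring_nf
  have hx4le6 : x ^ δ * x ^ δ * x ^ (2 * δ) ≤ x ^ (6 * δ) := by
    rw [xpow_add hx, xpow_add hx]; exact Real.rpow_le_rpow_of_exponent_le hx (by linarith)
  have h1 : C * S' * (R * S' + Nb) * (C + R * D) ≤
      (2 * S * (x ^ δ * N)) * (38 * x ^ (3 * δ) * N * (N + Hb)) * (4 * S * x ^ (2 * δ) * N) := by
    have hRS0 : 0 ≤ R * S' + Nb := add_nonneg (mul_nonneg hR0 hS'0) hNb0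
    gcongr
  have h2 : S' * Nb * R ≤ (x ^ δ * N) * (38 * x ^ δ * N * Hb) * (x ^ (2 * δ) * N) := by gcongr
  have h3 : (2 * S * (x ^ δ * N)) * (38 * x ^ (3 * δ) * N * (N + Hb)) * (4 * S * x ^ (2 * δ) * N) =
      304 * x ^ (6 * δ) * S ^ 2 * N ^ 3 * (N + Hb) := by rw [← hx6]; ring
  have h4 : (x ^ δ * N) * (38 * x ^ δ * N * Hb) * (x ^ (2 * δ) * N) ≤
      38 * x ^ (6 * δ) * S ^ 2 * N ^ 3 * (N + Hb) := by
    have e4 : (x ^ δ * N) * (38 * x ^ δ * N * Hb) * (x ^ (2 * δ) * N) =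
        38 * (x ^ δ * x ^ δ * x ^ (2 * δ)) * N ^ 3 * Hb := by ring
    rw [e4]
    have hS2 : (1 : ℝ) ≤ S ^ 2 := by nlinarith only [hS]
    have hHle : Hb ≤ S ^ 2 * (N + Hb) := by nlinarith only [hS2, hN0, hHb0]
    have hN3 : 0 ≤ N ^ 3 := by positivity
    calc 38 * (x ^ δ * x ^ δ * x ^ (2 * δ)) * N ^ 3 * Hb
        ≤ 38 * x ^ (6 * δ) * N ^ 3 * (S ^ 2 * (N + Hb)) := by gcongr
      _ = _ := by ring
  linarith only [h1, h2, h3, h4]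

/-- `√(R(RS'+Nb)) ≤ 7 x^{3δ} N √(N+Hb)`. [folklore] -/
theorem crude_sqrt (hx : 1 ≤ x) (hδ : 0 ≤ δ) (hN : 0 ≤ N) (hHb : 0 ≤ Hb) (hNb0 : 0 ≤ Nb)
    (hNb : Nb ≤ 38 * x ^ δ * N * Hb) (hR0 : 0 ≤ R) (hR : R ≤ x ^ (2 * δ) * N) (hS'0 : 0 ≤ S')
    (hS' : S' ≤ x ^ δ * N) :
    Real.sqrt (R * (R * S' + Nb)) ≤ 7 * x ^ (3 * δ) * N * Real.sqrt (N + Hb) := by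
  have hx0 : 0 < x := by linarith
  have xp : ∀ a : ℝ, 0 ≤ x ^ a := fun a => (Real.rpow_pos_of_pos hx0 a).le
  have hRSN := crude_RSN hx hδ hN hHb hNb hR hS'0 hS'
  have hNHb0 : 0 ≤ N + Hb := by positivity
  rw [Real.sqrt_le_left (by positivity)]
  have h1 : R * (R * S' + Nb) ≤ (x ^ (2 * δ) * N) * (38 * x ^ (3 * δ) * N * (N + Hb)) := by
    have hRS0 : 0 ≤ R * S' + Nb := add_nonneg (mul_nonneg hR0 hS'0) hNb0
    gcongr
  have h5 : x ^ (2 * δ) * x ^ (3 * δ) ≤ x ^ (3 * δ) * x ^ (3 * δ) :=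
    mul_le_mul_of_nonneg_right (Real.rpow_le_rpow_of_exponent_le hx (by linarith)) (xp _)
  have e2 : (7 * x ^ (3 * δ) * N * Real.sqrt (N + Hb)) ^ 2 =
      49 * (x ^ (3 * δ) * x ^ (3 * δ)) * (N ^ 2 * (N + Hb)) := by
    rw [mul_pow, mul_pow, mul_pow, Real.sq_sqrt hNHb0]; ring
  have e1 : (x ^ (2 * δ) * N) * (38 * x ^ (3 * δ) * N * (N + Hb)) =
      38 * (x ^ (2 * δ) * x ^ (3 * δ)) * (N ^ 2 * (N + Hb)) := by ring
  rw [e2]; rw [e1] at h1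
  have hw : 0 ≤ N ^ 2 * (N + Hb) := by positivity
  have h6 := mul_le_mul_of_nonneg_right h5 hw
  have h7 : 0 ≤ (x ^ (3 * δ) * x ^ (3 * δ)) * (N ^ 2 * (N + Hb)) := by positivity
  nlinarith only [h1, h6, h7]

/-- **`T' ≤ 56 x^{4δ} S³ N² √(N+Hb) + 152 x^{3δ} S² N² Hb`.** [cite: Drappeau2017, §5.5 p. 21] -/
theorem crude_T' (hx : 1 ≤ x) (hδ : 0 ≤ δ) (hS : 0 ≤ S) (hN : 0 ≤ N) (hHb : 0 ≤ Hb)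
    (hC0 : 0 ≤ C) (hC : C ≤ 2 * S) (hD0 : 0 ≤ D) (hD : D ≤ 2 * S) (hNb0 : 0 ≤ Nb)
    (hNb : Nb ≤ 38 * x ^ δ * N * Hb) (hR0 : 0 ≤ R) (hR : R ≤ x ^ (2 * δ) * N) (hS'0 : 0 ≤ S')
    (hS' : S' ≤ x ^ δ * N) :
    C ^ 2 * D * S' * Real.sqrt (R * (R * S' + Nb)) + D ^ 2 * Nb * R ≤
      56 * x ^ (4 * δ) * S ^ 3 * N ^ 2 * Real.sqrt (N + Hb) + 152 * x ^ (3 * δ) * S ^ 2 * N ^ 2 * Hb := by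
  have hx0 : 0 < x := by linarith
  have xp : ∀ a : ℝ, 0 ≤ x ^ a := fun a => (Real.rpow_pos_of_pos hx0 a).le
  have hsq := crude_sqrt hx hδ hN hHb hNb0 hNb hR0 hR hS'0 hS'
  have hx4 : x ^ δ * x ^ (3 * δ) = x ^ (4 * δ) := by rw [xpow_add hx]; ring_nf
  have hx3' : x ^ δ * x ^ (2 * δ) = x ^ (3 * δ) := by rw [xpow_add hx]; ring_nf
  have h1 : C ^ 2 * D * S' * Real.sqrt (R * (R * S' + Nb)) ≤
      (2 * S) ^ 2 * (2 * S) * (x ^ δ * N) * (7 * x ^ (3 * δ) * N * Real.sqrt (N + Hb)) := by gcongr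
  have h2 : D ^ 2 * Nb * R ≤ (2 * S) ^ 2 * (38 * x ^ δ * N * Hb) * (x ^ (2 * δ) * N) := by gcongr
  have e1 : (2 * S) ^ 2 * (2 * S) * (x ^ δ * N) * (7 * x ^ (3 * δ) * N * Real.sqrt (N + Hb)) =
      56 * (x ^ δ * x ^ (3 * δ)) * S ^ 3 * N ^ 2 * Real.sqrt (N + Hb) := by ring
  have e2 : (2 * S) ^ 2 * (38 * x ^ δ * N * Hb) * (x ^ (2 * δ) * N) =
      152 * (x ^ δ * x ^ (2 * δ)) * S ^ 2 * N ^ 2 * Hb := by ring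
  rw [e1, hx4] at h1; rw [e2, hx3'] at h2
  linarith only [h1, h2]

end Crude

/-! ### The savings -/

section Savings

variable {x η δ ε₁ ν S N : ℝ}

/-- Common hypotheses ⟹ the monomial bounds used for `E1, E2, E3`:
with `a = S²N x^{ε₁}/x`, `Hb = a + 1`, `E = 2ε₁ + 4δ − ν`, `E' = 2ε₁ + 3δ − ν`,
`ν ≤ 3η/4`, `ν ≤ 1/6`:
`N Hb (N+Hb) ≤ 6 S² x^E`, `Hb √(N+Hb) ≤ 8 S x^{E'}`, `Hb² ≤ 4 S² x^E`.
[cite: Drappeau2017, §5.5 p. 21] -/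
theorem savings (hx : 1 ≤ x) (hη : 0 < η) (hη' : η ≤ 1 / 9) (hδ : 0 ≤ δ) (hε₁ : 0 ≤ ε₁)
    (hν1 : ν ≤ 3 * η / 4) (hν2 : ν ≤ 1 / 6)
    (hSx : x ^ (1 / 4 : ℝ) ≤ S) (hSx' : S ≤ x ^ (1 / 2 + δ)) (hN1 : 1 ≤ N)
    (hNS : N ≤ S ^ (2 / 3 - η)) :
    N * (S ^ 2 * N * x ^ ε₁ / x + 1) * (N + (S ^ 2 * N * x ^ ε₁ / x + 1)) ≤
        6 * (S ^ 2 * x ^ (2 * ε₁ + 4 * δ - ν)) ∧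
      (S ^ 2 * N * x ^ ε₁ / x + 1) * Real.sqrt (N + (S ^ 2 * N * x ^ ε₁ / x + 1)) ≤
        8 * (S * x ^ (2 * ε₁ + 3 * δ - ν)) ∧
      (S ^ 2 * N * x ^ ε₁ / x + 1) ^ 2 ≤ 4 * (S ^ 2 * x ^ (2 * ε₁ + 4 * δ - ν)) := by
  have hx0 : 0 < x := by linarith
  have xp : ∀ a : ℝ, 0 < x ^ a := fun a => Real.rpow_pos_of_pos hx0 a
  have xp1 : ∀ a : ℝ, 0 ≤ a → 1 ≤ x ^ a := fun a ha => one_le_xpow hx ha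
  have hS1 : 1 ≤ S := le_trans (xp1 _ (by norm_num)) hSx
  have hS0 : 0 ≤ S := by linarith
  have hSp : 0 < S := by linarith
  have hN0 : 0 ≤ N := by linarith
  set a : ℝ := S ^ 2 * N * x ^ ε₁ / x with hadef
  have ha0 : 0 ≤ a := by positivity
  set Hb : ℝ := a + 1 with hHb
  have hHb0 : 0 ≤ Hb := by positivity
  have hxm1 : x ^ (-1 : ℝ) = x⁻¹ := Real.rpow_neg_one x
  -- `N³ ≤ x^{1+2δ-3η/2}`, `N^{3/2} S ≤ x^{1+2δ-3η/4}`
  have hN3 : N ^ 3 ≤ x ^ (1 + 2 * δ - 3 * η / 2) := by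
    have h1 : N ^ (3 : ℝ) ≤ S ^ ((2 / 3 - η) * 3) := (by rw [Real.rpow_mul hS0]; exact Real.rpow_le_rpow hN0 hNS (by norm_num))
    have h2 : S ^ ((2 / 3 - η) * 3) ≤ (x ^ (1 / 2 + δ)) ^ ((2 / 3 - η) * 3) :=
      Real.rpow_le_rpow hS0 hSx' (by nlinarith only [hη'])
    rw [← Real.rpow_mul hx0.le] at h2
    have h3 : x ^ ((1 / 2 + δ) * ((2 / 3 - η) * 3)) ≤ x ^ (1 + 2 * δ - 3 * η / 2) :=
      Real.rpow_le_rpow_of_exponent_le hx (by nlinarith only [hη, hδ])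
    calc N ^ 3 = N ^ ((3 : ℕ) : ℝ) := (Real.rpow_natCast N 3).symm
      _ = N ^ (3 : ℝ) := by norm_num
      _ ≤ _ := h1.trans (h2.trans h3)
  have hN32S : N ^ (3 / 2 : ℝ) * S ≤ x ^ (1 + 2 * δ - 3 * η / 4) := by
    have h1 : N ^ (3 / 2 : ℝ) ≤ S ^ ((2 / 3 - η) * (3 / 2)) := (by rw [Real.rpow_mul hS0]; exact Real.rpow_le_rpow hN0 hNS (by norm_num))
    have h2 : N ^ (3 / 2 : ℝ) * S ≤ S ^ ((2 / 3 - η) * (3 / 2) + 1) := by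
      rw [Real.rpow_add hSp, Real.rpow_one]; gcongr
    have h3 : S ^ ((2 / 3 - η) * (3 / 2) + 1) ≤ (x ^ (1 / 2 + δ)) ^ ((2 / 3 - η) * (3 / 2) + 1) :=
      Real.rpow_le_rpow hS0 hSx' (by nlinarith only [hη'])
    rw [← Real.rpow_mul hx0.le] at h3
    exact h2.trans (h3.trans (Real.rpow_le_rpow_of_exponent_le hx (by nlinarith only [hη, hδ])))
  have hS2x : S ^ 2 ≤ x ^ (1 + 2 * δ) := by
    have := Real.rpow_le_rpow hS0 hSx' (by norm_num : (0 : ℝ) ≤ 2)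
    rw [← Real.rpow_mul hx0.le, show ((1 / 2 + δ) * 2 : ℝ) = 1 + 2 * δ by ring] at this
    calc S ^ 2 = S ^ ((2 : ℕ) : ℝ) := (Real.rpow_natCast S 2).symm
      _ = S ^ (2 : ℝ) := by norm_num
      _ ≤ _ := this
  have hNS23 : N ≤ S ^ (2 / 3 : ℝ) := hNS.trans (Real.rpow_le_rpow_of_exponent_le hS1 (by linarith))
  have hSN : S * N ≤ x ^ (5 / 6 + 2 * δ) := by
    have h1 : S * N ≤ S ^ (5 / 3 : ℝ) := by
      calc S * N ≤ S * S ^ (2 / 3 : ℝ) := by gcongr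
        _ = S ^ (5 / 3 : ℝ) := by
            rw [show (5 / 3 : ℝ) = 1 + 2 / 3 by norm_num, Real.rpow_add hSp, Real.rpow_one]
    have h2 : S ^ (5 / 3 : ℝ) ≤ (x ^ (1 / 2 + δ)) ^ (5 / 3 : ℝ) := Real.rpow_le_rpow hS0 hSx' (by norm_num)
    rw [← Real.rpow_mul hx0.le] at h2
    exact h1.trans (h2.trans (Real.rpow_le_rpow_of_exponent_le hx (by nlinarith only [hδ])))
  have hS2r : (S : ℝ) ^ (2 : ℝ) = S ^ 2 := by rw [← Real.rpow_natCast]; norm_num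
  have hN2 : N ^ 2 ≤ S ^ 2 * x ^ (-(1 / 6) : ℝ) := by
    have h1 : N ^ 2 ≤ S ^ (4 / 3 : ℝ) := by
      have := (show N ^ (2 : ℝ) ≤ S ^ (2 / 3 * 2 : ℝ) by rw [Real.rpow_mul hS0]; exact Real.rpow_le_rpow hN0 hNS23 (by norm_num))
      rw [show (2 / 3 * 2 : ℝ) = 4 / 3 by ring] at this
      calc N ^ 2 = N ^ ((2 : ℕ) : ℝ) := (Real.rpow_natCast N 2).symm
        _ = N ^ (2 : ℝ) := by norm_num
        _ ≤ _ := this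
    have h2 := Spow_le_mul_xpow (p := 4 / 3) (r := 2) hx0 hSx (by norm_num)
    rw [show ((4 / 3 - 2) / 4 : ℝ) = -(1 / 6) by norm_num, hS2r] at h2
    exact h1.trans h2
  have hN1' : N ≤ S ^ 2 * x ^ (-(1 / 3) : ℝ) := by
    have h2 := Spow_le_mul_xpow (p := 2 / 3) (r := 2) hx0 hSx (by norm_num)
    rw [show ((2 / 3 - 2) / 4 : ℝ) = -(1 / 3) by norm_num, hS2r] at h2
    exact hNS23.trans h2
  have hsqrtN : Real.sqrt N ≤ S * x ^ (-(1 / 6) : ℝ) := by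
    have h1 : Real.sqrt N ≤ S ^ (1 / 3 : ℝ) := by
      rw [Real.sqrt_eq_rpow]
      have := (show N ^ (1 / 2 : ℝ) ≤ S ^ (2 / 3 * (1 / 2) : ℝ) by rw [Real.rpow_mul hS0]; exact Real.rpow_le_rpow hN0 hNS23 (by norm_num))
      rw [show (2 / 3 * (1 / 2) : ℝ) = 1 / 3 by ring] at this; exact this
    have h2 := Spow_le_mul_xpow (p := 1 / 3) (r := 1) hx0 hSx (by norm_num)
    rw [show ((1 / 3 - 1) / 4 : ℝ) = -(1 / 6) by norm_num, Real.rpow_one] at h2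
    exact h1.trans h2
  have hone1 : (1 : ℝ) ≤ S * x ^ (-(1 / 4) : ℝ) := by
    have h2 := Spow_le_mul_xpow (p := 0) (r := 1) hx0 hSx (by norm_num)
    rw [Real.rpow_zero, Real.rpow_one, show ((0 - 1) / 4 : ℝ) = -(1 / 4) by norm_num] at h2
    exact h2
  have hone2 : (1 : ℝ) ≤ S ^ 2 * x ^ (-(1 / 2) : ℝ) := by
    have h2 := Spow_le_mul_xpow (p := 0) (r := 2) hx0 hSx (by norm_num)
    rw [Real.rpow_zero, show ((0 - 2) / 4 : ℝ) = -(1 / 2) by norm_num, hS2r] at h2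
    exact h2
  -- monomials in `a`
  have ha1 : a ≤ S * x ^ (-(1 / 6) + 2 * δ + ε₁) := by
    have : a = S * ((S * N) * x ^ ε₁ * x ^ (-1 : ℝ)) := by rw [hadef, hxm1]; ring
    rw [this]
    gcongr
    calc (S * N) * x ^ ε₁ * x ^ (-1 : ℝ) ≤ x ^ (5 / 6 + 2 * δ) * x ^ ε₁ * x ^ (-1 : ℝ) := by gcongr
      _ = x ^ (-(1 / 6) + 2 * δ + ε₁) := by rw [xpow_add hx, xpow_add hx]; ring_nf
  have hN2a : N ^ 2 * a ≤ S ^ 2 * x ^ (2 * δ + ε₁ - 3 * η / 2) := by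
    have : N ^ 2 * a = S ^ 2 * (N ^ 3 * x ^ ε₁ * x ^ (-1 : ℝ)) := by rw [hadef, hxm1]; ring
    rw [this]
    gcongr
    calc N ^ 3 * x ^ ε₁ * x ^ (-1 : ℝ) ≤ x ^ (1 + 2 * δ - 3 * η / 2) * x ^ ε₁ * x ^ (-1 : ℝ) := by gcongr
      _ = x ^ (2 * δ + ε₁ - 3 * η / 2) := by rw [xpow_add hx, xpow_add hx]; ring_nf
  have hNa2 : N * a ^ 2 ≤ S ^ 2 * x ^ (4 * δ + 2 * ε₁ - 3 * η / 2) := by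
    have : N * a ^ 2 = S ^ 2 * (S ^ 2 * N ^ 3 * (x ^ ε₁ * x ^ ε₁) * (x ^ (-1 : ℝ) * x ^ (-1 : ℝ))) := by
      rw [hadef, hxm1]; ring
    rw [this]
    gcongr
    calc S ^ 2 * N ^ 3 * (x ^ ε₁ * x ^ ε₁) * (x ^ (-1 : ℝ) * x ^ (-1 : ℝ))
        ≤ x ^ (1 + 2 * δ) * x ^ (1 + 2 * δ - 3 * η / 2) * (x ^ ε₁ * x ^ ε₁) * (x ^ (-1 : ℝ) * x ^ (-1 : ℝ)) := by
          gcongr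
      _ = x ^ (4 * δ + 2 * ε₁ - 3 * η / 2) := by
          rw [xpow_add hx, xpow_add hx, xpow_add hx, xpow_add hx, xpow_add hx]; ring_nf
  have hsN : Real.sqrt N = N ^ (1 / 2 : ℝ) := Real.sqrt_eq_rpow N
  have hN32 : N ^ (3 / 2 : ℝ) = N * Real.sqrt N := by
    rw [hsN, show (3 / 2 : ℝ) = 1 + 1 / 2 by norm_num, Real.rpow_add (by linarith), Real.rpow_one]
  have hasN : a * Real.sqrt N ≤ S * x ^ (2 * δ + ε₁ - 3 * η / 4) := by
    have : a * Real.sqrt N = S * ((N ^ (3 / 2 : ℝ) * S) * x ^ ε₁ * x ^ (-1 : ℝ)) := by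
      rw [hadef, hxm1, hN32]; ring
    rw [this]
    gcongr
    calc (N ^ (3 / 2 : ℝ) * S) * x ^ ε₁ * x ^ (-1 : ℝ) ≤ x ^ (1 + 2 * δ - 3 * η / 4) * x ^ ε₁ * x ^ (-1 : ℝ) := by
          gcongr
      _ = x ^ (2 * δ + ε₁ - 3 * η / 4) := by rw [xpow_add hx, xpow_add hx]; ring_nf
  have ha32 : a ^ (3 / 2 : ℝ) ≤ S * x ^ (3 * δ + 3 / 2 * ε₁ - 3 * η / 4) := by
    have e1 : a ^ (3 / 2 : ℝ) = a * Real.sqrt a := by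
      rw [Real.sqrt_eq_rpow, show (3 / 2 : ℝ) = 1 + 1 / 2 by norm_num]
      rcases eq_or_lt_of_le ha0 with h0 | hpos
      · rw [← h0, zero_mul, Real.zero_rpow (by norm_num)]
      · rw [Real.rpow_add hpos, Real.rpow_one]
    have e2 : Real.sqrt a = S * Real.sqrt N * Real.sqrt (x ^ ε₁) * Real.sqrt (x⁻¹) := by
      rw [hadef, div_eq_mul_inv, Real.sqrt_mul (by positivity), Real.sqrt_mul (by positivity),
        Real.sqrt_mul (by positivity), Real.sqrt_sq hS0]
    have e3 : Real.sqrt (x ^ ε₁) = x ^ (ε₁ / 2) := by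
      rw [Real.sqrt_eq_rpow, ← Real.rpow_mul hx0.le]; ring_nf
    have e4 : Real.sqrt (x⁻¹) = x ^ (-(1 / 2) : ℝ) := by
      rw [Real.sqrt_eq_rpow, ← Real.rpow_neg_one, ← Real.rpow_mul hx0.le]; norm_num
    rw [e1, e2, e3, e4]
    have : a * (S * Real.sqrt N * x ^ (ε₁ / 2) * x ^ (-(1 / 2) : ℝ)) =
        S * ((a * Real.sqrt N) * x ^ (ε₁ / 2) * x ^ (-(1 / 2) : ℝ)) := by ring
    rw [this]
    gcongr
    calc (a * Real.sqrt N) * x ^ (ε₁ / 2) * x ^ (-(1 / 2) : ℝ)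
        ≤ (S * x ^ (2 * δ + ε₁ - 3 * η / 4)) * x ^ (ε₁ / 2) * x ^ (-(1 / 2) : ℝ) := by gcongr
      _ = S * x ^ (2 * δ + 3 / 2 * ε₁ - 3 * η / 4 - 1 / 2) := by
          rw [mul_assoc, mul_assoc, xpow_add hx, xpow_add hx]; ring_nf
      _ ≤ x ^ (1 / 2 + δ) * x ^ (2 * δ + 3 / 2 * ε₁ - 3 * η / 4 - 1 / 2) := by gcongr
      _ = x ^ (3 * δ + 3 / 2 * ε₁ - 3 * η / 4) := by rw [xpow_add hx]; ring_nf
  -- E1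
  set E : ℝ := 2 * ε₁ + 4 * δ - ν with hE
  have hxE : ∀ t : ℝ, t ≤ E → x ^ t ≤ x ^ E := fun t ht => Real.rpow_le_rpow_of_exponent_le hx ht
  have hHb2 : Hb ^ 2 ≤ 2 * a ^ 2 + 2 := by rw [hHb]; nlinarith only [sq_nonneg (a - 1)]
  have hE1 : N * Hb * (N + Hb) ≤ 6 * (S ^ 2 * x ^ E) := by
    have hexpand : N * Hb * (N + Hb) = N ^ 2 * a + N ^ 2 + N * Hb ^ 2 := by rw [hHb]; ring
    rw [hexpand]
    have t1 : N ^ 2 * a ≤ S ^ 2 * x ^ E :=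
      hN2a.trans (mul_le_mul_of_nonneg_left (hxE _ (by rw [hE]; linarith only [hν1, hε₁, hδ, hη])) (by positivity))
    have t2 : N ^ 2 ≤ S ^ 2 * x ^ E :=
      hN2.trans (mul_le_mul_of_nonneg_left (hxE _ (by rw [hE]; linarith only [hν2, hε₁, hδ])) (by positivity))
    have t3a : N * a ^ 2 ≤ S ^ 2 * x ^ E :=
      hNa2.trans (mul_le_mul_of_nonneg_left (hxE _ (by rw [hE]; linarith only [hν1, hε₁, hδ, hη])) (by positivity))
    have t3b : N ≤ S ^ 2 * x ^ E :=
      hN1'.trans (mul_le_mul_of_nonneg_left (hxE _ (by rw [hE]; linarith only [hν2, hε₁, hδ])) (by positivity))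
    have t3 : N * Hb ^ 2 ≤ 4 * (S ^ 2 * x ^ E) := by
      calc N * Hb ^ 2 ≤ N * (2 * a ^ 2 + 2) := by gcongr
        _ = 2 * (N * a ^ 2) + 2 * N := by ring
        _ ≤ 2 * (S ^ 2 * x ^ E) + 2 * (S ^ 2 * x ^ E) := by gcongr
        _ = 4 * (S ^ 2 * x ^ E) := by ring
    linarith only [t1, t2, t3]
  -- E2
  have h232 : (2 : ℝ) ^ (3 / 2 : ℝ) ≤ 3 := by
    have h : ((2 : ℝ) ^ (3 / 2 : ℝ)) ^ (2 : ℝ) = 8 := by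
      rw [← Real.rpow_mul (by norm_num)]; norm_num
    have h' : ((2 : ℝ) ^ (3 / 2 : ℝ)) ^ (2 : ℝ) = ((2 : ℝ) ^ (3 / 2 : ℝ)) ^ 2 := by
      rw [← Real.rpow_natCast]; norm_num
    have hp : 0 ≤ (2 : ℝ) ^ (3 / 2 : ℝ) := by positivity
    nlinarith only [h.symm.trans h', hp]
  have hHb32 : Hb ^ (3 / 2 : ℝ) ≤ 3 * (a ^ (3 / 2 : ℝ) + 1) := by
    have ha32' : 0 ≤ a ^ (3 / 2 : ℝ) := by positivity
    rcases le_total a 1 with hle | hge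
    · have h1 : Hb ≤ 2 := by rw [hHb]; linarith only [hle]
      calc Hb ^ (3 / 2 : ℝ) ≤ (2 : ℝ) ^ (3 / 2 : ℝ) := Real.rpow_le_rpow hHb0 h1 (by norm_num)
        _ ≤ 3 := h232
        _ ≤ _ := by linarith only [ha32']
    · have h1 : Hb ≤ 2 * a := by rw [hHb]; linarith only [hge]
      calc Hb ^ (3 / 2 : ℝ) ≤ (2 * a) ^ (3 / 2 : ℝ) := Real.rpow_le_rpow hHb0 h1 (by norm_num)
        _ = (2 : ℝ) ^ (3 / 2 : ℝ) * a ^ (3 / 2 : ℝ) := Real.mul_rpow (by norm_num) ha0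
        _ ≤ 3 * a ^ (3 / 2 : ℝ) := by gcongr
        _ ≤ _ := by linarith only [ha32']
  set E2x : ℝ := 2 * ε₁ + 3 * δ - ν with hE2x
  have hxE2 : ∀ t : ℝ, t ≤ E2x → x ^ t ≤ x ^ E2x := fun t ht => Real.rpow_le_rpow_of_exponent_le hx ht
  have hE2 : Hb * Real.sqrt (N + Hb) ≤ 8 * (S * x ^ E2x) := by
    have hsqrt : Real.sqrt (N + Hb) ≤ Real.sqrt N + Real.sqrt Hb := by
      rw [Real.sqrt_le_left (by positivity)]
      nlinarith only [Real.sq_sqrt hN0, Real.sq_sqrt hHb0, Real.sqrt_nonneg N, Real.sqrt_nonneg Hb]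
    have hHbs : Hb * Real.sqrt Hb = Hb ^ (3 / 2 : ℝ) := by
      rw [Real.sqrt_eq_rpow, show (3 / 2 : ℝ) = 1 + 1 / 2 by norm_num, Real.rpow_add (by positivity),
        Real.rpow_one]
    have u1 : a * Real.sqrt N ≤ S * x ^ E2x :=
      hasN.trans (mul_le_mul_of_nonneg_left (hxE2 _ (by rw [hE2x]; linarith only [hν1, hε₁, hδ])) (by positivity))
    have u2 : Real.sqrt N ≤ S * x ^ E2x :=
      hsqrtN.trans (mul_le_mul_of_nonneg_left (hxE2 _ (by rw [hE2x]; linarith only [hν2, hε₁, hδ])) (by positivity))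
    have u3 : a ^ (3 / 2 : ℝ) ≤ S * x ^ E2x :=
      ha32.trans (mul_le_mul_of_nonneg_left (hxE2 _ (by rw [hE2x]; linarith only [hν1, hε₁, hδ])) (by positivity))
    have u4 : (1 : ℝ) ≤ S * x ^ E2x :=
      hone1.trans (mul_le_mul_of_nonneg_left (hxE2 _ (by rw [hE2x]; linarith only [hν2, hε₁, hδ])) (by positivity))
    have t1 : Hb * Real.sqrt N ≤ 2 * (S * x ^ E2x) := by
      have : Hb * Real.sqrt N = a * Real.sqrt N + Real.sqrt N := by rw [hHb]; ring
      rw [this]; linarith only [u1, u2]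
    have t2 : Hb ^ (3 / 2 : ℝ) ≤ 6 * (S * x ^ E2x) := by linarith only [hHb32, u3, u4]
    calc Hb * Real.sqrt (N + Hb) ≤ Hb * (Real.sqrt N + Real.sqrt Hb) := by gcongr
      _ = Hb * Real.sqrt N + Hb ^ (3 / 2 : ℝ) := by rw [mul_add, hHbs]
      _ ≤ _ := by linarith only [t1, t2]
  -- E3
  have hE3 : Hb ^ 2 ≤ 4 * (S ^ 2 * x ^ E) := by
    have t1 : a ^ 2 ≤ S ^ 2 * x ^ E := by
      calc a ^ 2 ≤ (S * x ^ (-(1 / 6) + 2 * δ + ε₁)) ^ 2 := by gcongr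
        _ = S ^ 2 * x ^ (2 * (-(1 / 6) + 2 * δ + ε₁)) := by
            rw [mul_pow, show (x ^ (-(1 / 6) + 2 * δ + ε₁)) ^ 2 = x ^ (-(1 / 6) + 2 * δ + ε₁) *
              x ^ (-(1 / 6) + 2 * δ + ε₁) by ring, xpow_add hx]; ring_nf
        _ ≤ S ^ 2 * x ^ E :=
            mul_le_mul_of_nonneg_left (hxE _ (by rw [hE]; linarith only [hν2, hε₁, hδ])) (by positivity)
    have t2 : (1 : ℝ) ≤ S ^ 2 * x ^ E :=
      hone2.trans (mul_le_mul_of_nonneg_left (hxE _ (by rw [hE]; linarith only [hν2, hε₁, hδ])) (by positivity))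
    linarith only [hHb2, t1, t2]
  exact ⟨hE1, hE2, hE3⟩

end Savings

/-! ### The bound -/

section Main

variable {x η δ κ ε₁ e θ S N H q C D Nb R S' Sb W A : ℝ}

set_option maxHeartbeats 400000 in
/-- **The right-hand side of Theorem 2.1 at the parameters of a blocked piece of `ℛ₁''` is
`≤ 169632·A·W·N²S²·x^{−8κ}`.** [cite: Drappeau2017, §5.5 p. 21, (5.24)–(5.25)] -/
theorem cruxRHS_le (hx : 1 ≤ x) (hη : 0 < η) (hη' : η ≤ 1 / 9)
    (hδ : 0 ≤ δ) (hκ : 0 ≤ κ) (hε₁ : 0 ≤ ε₁) (he : 0 ≤ e) (he1 : e ≤ 1) (hθ : θ = δ + κ)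
    (hδs : δ ≤ 1 / 100) (hκs : κ ≤ 1 / 100) (hε₁s : ε₁ ≤ 1 / 100)
    (hexp : 7 / 2 * e + 15 / 2 * δ + 21 / 2 * κ + ε₁ ≤ min (3 * η / 4) (1 / 6) / 2)
    (hSx : x ^ (1 / 4 : ℝ) ≤ S) (hSx' : S ≤ x ^ (1 / 2 + δ)) (hN1 : 1 ≤ N)
    (hNS : N ≤ S ^ (2 / 3 - η))
    (hH : H ≤ 9 * S ^ 2 * N * x ^ ε₁ / x + 1)
    (hq1 : 1 ≤ q) (hq : q ≤ x ^ θ) (hC0 : 0 ≤ C) (hC : C ≤ 2 * S)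
    (hD0 : 0 ≤ D) (hD : D ≤ 2 * S) (hNb0 : 0 ≤ Nb) (hNb : Nb ≤ 4 * x ^ δ * H * N + 2)
    (hR0 : 0 ≤ R) (hR : R ≤ x ^ (2 * δ) * N) (hS'0 : 0 ≤ S') (hS' : S' ≤ x ^ δ * N)
    (hSb0 : 0 ≤ Sb) (hSb : Sb ≤ 10 * N ^ 2 * (H + 1) * W ^ 2) (hW0 : 0 ≤ W) (hA : 0 ≤ A) :
    A * (q * C * D * Nb * R * S') ^ e * q ^ (3 / 2 : ℝ) *
        Real.sqrt (q ^ 2 * (C * S' * (R * S' + Nb) * (C + R * D) + S' * Nb * R) * Sb +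
          q * (C ^ 2 * D * S' * Real.sqrt (R * (R * S' + Nb)) + D ^ 2 * Nb * R) * Sb) ≤
      169632 * A * W * N ^ 2 * S ^ 2 * x ^ (-8 * κ) := by
  have hx0 : 0 < x := by linarith
  have xp : ∀ a : ℝ, 0 < x ^ a := fun a => Real.rpow_pos_of_pos hx0 a
  have xp1 : ∀ a : ℝ, 0 ≤ a → 1 ≤ x ^ a := fun a ha => one_le_xpow hx ha
  have hS1 : 1 ≤ S := le_trans (xp1 _ (by norm_num)) hSx
  have hS0 : 0 ≤ S := by linarith
  have hN0 : 0 ≤ N := by linarith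
  set ν := min (3 * η / 4) (1 / 6) with hνdef
  have hν1 : ν ≤ 3 * η / 4 := min_le_left _ _
  have hν2 : ν ≤ 1 / 6 := min_le_right _ _
  set a : ℝ := S ^ 2 * N * x ^ ε₁ / x with hadef
  have ha0 : 0 ≤ a := by positivity
  set Hb : ℝ := a + 1 with hHb
  have hHb1 : 1 ≤ Hb := by linarith only [ha0]
  have hHb0 : 0 ≤ Hb := by linarith only [hHb1]
  have hH9 : H ≤ 9 * Hb := by
    rw [hHb, hadef]
    have e9 : (9 : ℝ) * (S ^ 2 * N * x ^ ε₁ / x + 1) = 9 * S ^ 2 * N * x ^ ε₁ / x + 9 := by ring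
    rw [e9]; linarith only [hH]
  -- `Nb ≤ 38 x^δ N Hb`, `Sb ≤ 100 N² Hb W²`
  have hxδ1 := xp1 δ hδ
  have hNb' : Nb ≤ 38 * x ^ δ * N * Hb := by
    have h1 : 4 * x ^ δ * H * N ≤ 36 * x ^ δ * N * Hb := by
      have h4 : 0 ≤ 4 * x ^ δ * N := by positivity
      have := mul_le_mul_of_nonneg_left hH9 h4
      linarith only [this]
    have h2 : (1 : ℝ) ≤ x ^ δ * N * Hb := by
      calc (1 : ℝ) = 1 * 1 * 1 := by ring
        _ ≤ x ^ δ * N * Hb := by gcongr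
    linarith only [hNb, h1, h2]
  have hSb' : Sb ≤ 100 * N ^ 2 * Hb * W ^ 2 := by
    calc Sb ≤ 10 * N ^ 2 * (H + 1) * W ^ 2 := hSb
      _ ≤ 10 * N ^ 2 * (10 * Hb) * W ^ 2 := by
          have hH10 : H + 1 ≤ 10 * Hb := by linarith only [hH9, hHb1]
          gcongr
      _ = _ := by ring
  have hT := crude_T hx hδ hS1 hN1 hHb1 hC0 hC hD0 hD hNb0 hNb' hR0 hR hS'0 hS'
  have hT' := crude_T' hx hδ hS0 hN0 hHb0 hC0 hC hD0 hD hNb0 hNb' hR0 hR hS'0 hS'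
  obtain ⟨hE1, hE2, hE3⟩ := savings hx hη hη' hδ hε₁ hν1 hν2 hSx hSx' hN1 hNS
  rw [← hadef, ← hHb] at hE1 hE2 hE3
  set E : ℝ := 2 * ε₁ + 4 * δ - ν with hE
  set E2x : ℝ := 2 * ε₁ + 3 * δ - ν with hE2x
  -- inside the square root
  have hθ0 : 0 ≤ θ := by rw [hθ]; positivity
  have hq0 : 0 ≤ q := by linarith only [hq1]
  have hq2 : q ^ 2 ≤ x ^ (2 * θ) := by
    calc q ^ 2 ≤ (x ^ θ) ^ 2 := by gcongr
      _ = x ^ (2 * θ) := by rw [sq, xpow_add hx]; ring_nf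
  have hqθ2 : q ≤ x ^ (2 * θ) := hq.trans (Real.rpow_le_rpow_of_exponent_le hx (by linarith only [hθ0]))
  set F : ℝ := 2 * θ + 10 * δ + 2 * ε₁ - ν with hF
  have hIn : q ^ 2 * (C * S' * (R * S' + Nb) * (C + R * D) + S' * Nb * R) * Sb +
      q * (C ^ 2 * D * S' * Real.sqrt (R * (R * S' + Nb)) + D ^ 2 * Nb * R) * Sb ≤
      310800 * W ^ 2 * x ^ F * N ^ 4 * S ^ 4 := by
    have hT0 : 0 ≤ C * S' * (R * S' + Nb) * (C + R * D) + S' * Nb * R := by positivity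
    have hT'0 : 0 ≤ C ^ 2 * D * S' * Real.sqrt (R * (R * S' + Nb)) + D ^ 2 * Nb * R := by positivity
    have s1 : q ^ 2 * (C * S' * (R * S' + Nb) * (C + R * D) + S' * Nb * R) * Sb ≤
        x ^ (2 * θ) * (342 * x ^ (6 * δ) * S ^ 2 * N ^ 3 * (N + Hb)) * (100 * N ^ 2 * Hb * W ^ 2) := by
      gcongr
    have s1' : x ^ (2 * θ) * (342 * x ^ (6 * δ) * S ^ 2 * N ^ 3 * (N + Hb)) * (100 * N ^ 2 * Hb * W ^ 2)
        = 34200 * W ^ 2 * (x ^ (2 * θ) * x ^ (6 * δ)) * N ^ 4 * S ^ 2 * (N * Hb * (N + Hb)) := by ring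
    have s1'' : 34200 * W ^ 2 * (x ^ (2 * θ) * x ^ (6 * δ)) * N ^ 4 * S ^ 2 * (N * Hb * (N + Hb)) ≤
        34200 * W ^ 2 * (x ^ (2 * θ) * x ^ (6 * δ)) * N ^ 4 * S ^ 2 * (6 * (S ^ 2 * x ^ E)) := by gcongr
    have x1 : (x ^ (2 * θ) * x ^ (6 * δ)) * x ^ E ≤ x ^ F := by
      rw [xpow_add hx, xpow_add hx]; exact Real.rpow_le_rpow_of_exponent_le hx (by rw [hF, hE]; linarith only [hδ])
    have s2 : q * (C ^ 2 * D * S' * Real.sqrt (R * (R * S' + Nb)) + D ^ 2 * Nb * R) * Sb ≤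
        x ^ (2 * θ) * (56 * x ^ (4 * δ) * S ^ 3 * N ^ 2 * Real.sqrt (N + Hb) +
          152 * x ^ (3 * δ) * S ^ 2 * N ^ 2 * Hb) * (100 * N ^ 2 * Hb * W ^ 2) := by
      gcongr
    have s2' : x ^ (2 * θ) * (56 * x ^ (4 * δ) * S ^ 3 * N ^ 2 * Real.sqrt (N + Hb) +
          152 * x ^ (3 * δ) * S ^ 2 * N ^ 2 * Hb) * (100 * N ^ 2 * Hb * W ^ 2) =
        5600 * W ^ 2 * (x ^ (2 * θ) * x ^ (4 * δ)) * N ^ 4 * S ^ 3 * (Hb * Real.sqrt (N + Hb)) +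
        15200 * W ^ 2 * (x ^ (2 * θ) * x ^ (3 * δ)) * N ^ 4 * S ^ 2 * Hb ^ 2 := by ring
    have s2a : 5600 * W ^ 2 * (x ^ (2 * θ) * x ^ (4 * δ)) * N ^ 4 * S ^ 3 * (Hb * Real.sqrt (N + Hb)) ≤
        5600 * W ^ 2 * (x ^ (2 * θ) * x ^ (4 * δ)) * N ^ 4 * S ^ 3 * (8 * (S * x ^ E2x)) := by gcongr
    have s2b : 15200 * W ^ 2 * (x ^ (2 * θ) * x ^ (3 * δ)) * N ^ 4 * S ^ 2 * Hb ^ 2 ≤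
        15200 * W ^ 2 * (x ^ (2 * θ) * x ^ (3 * δ)) * N ^ 4 * S ^ 2 * (4 * (S ^ 2 * x ^ E)) := by gcongr
    have x2 : (x ^ (2 * θ) * x ^ (4 * δ)) * x ^ E2x ≤ x ^ F := by
      rw [xpow_add hx, xpow_add hx]; exact Real.rpow_le_rpow_of_exponent_le hx (by rw [hF, hE2x]; linarith only [hδ])
    have x3 : (x ^ (2 * θ) * x ^ (3 * δ)) * x ^ E ≤ x ^ F := by
      rw [xpow_add hx, xpow_add hx]; exact Real.rpow_le_rpow_of_exponent_le hx (by rw [hF, hE]; linarith only [hδ])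
    have f1 : 34200 * W ^ 2 * (x ^ (2 * θ) * x ^ (6 * δ)) * N ^ 4 * S ^ 2 * (6 * (S ^ 2 * x ^ E)) ≤
        205200 * W ^ 2 * x ^ F * N ^ 4 * S ^ 4 := by
      have : 34200 * W ^ 2 * (x ^ (2 * θ) * x ^ (6 * δ)) * N ^ 4 * S ^ 2 * (6 * (S ^ 2 * x ^ E)) =
          205200 * W ^ 2 * ((x ^ (2 * θ) * x ^ (6 * δ)) * x ^ E) * N ^ 4 * S ^ 4 := by ring
      rw [this]; gcongr
    have f2 : 5600 * W ^ 2 * (x ^ (2 * θ) * x ^ (4 * δ)) * N ^ 4 * S ^ 3 * (8 * (S * x ^ E2x)) ≤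
        44800 * W ^ 2 * x ^ F * N ^ 4 * S ^ 4 := by
      have : 5600 * W ^ 2 * (x ^ (2 * θ) * x ^ (4 * δ)) * N ^ 4 * S ^ 3 * (8 * (S * x ^ E2x)) =
          44800 * W ^ 2 * ((x ^ (2 * θ) * x ^ (4 * δ)) * x ^ E2x) * N ^ 4 * S ^ 4 := by ring
      rw [this]; gcongr
    have f3 : 15200 * W ^ 2 * (x ^ (2 * θ) * x ^ (3 * δ)) * N ^ 4 * S ^ 2 * (4 * (S ^ 2 * x ^ E)) ≤
        60800 * W ^ 2 * x ^ F * N ^ 4 * S ^ 4 := by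
      have : 15200 * W ^ 2 * (x ^ (2 * θ) * x ^ (3 * δ)) * N ^ 4 * S ^ 2 * (4 * (S ^ 2 * x ^ E)) =
          60800 * W ^ 2 * ((x ^ (2 * θ) * x ^ (3 * δ)) * x ^ E) * N ^ 4 * S ^ 4 := by ring
      rw [this]; gcongr
    linarith only [s1, s1', s1'', f1, s2, s2', s2a, s2b, f2, f3]
  -- the square root
  have hsqrtIn : Real.sqrt (q ^ 2 * (C * S' * (R * S' + Nb) * (C + R * D) + S' * Nb * R) * Sb +
      q * (C ^ 2 * D * S' * Real.sqrt (R * (R * S' + Nb)) + D ^ 2 * Nb * R) * Sb) ≤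
      558 * W * x ^ (F / 2) * N ^ 2 * S ^ 2 := by
    refine (Real.sqrt_le_sqrt hIn).trans ?_
    rw [Real.sqrt_le_left (by positivity)]
    have e1 : (558 * W * x ^ (F / 2) * N ^ 2 * S ^ 2) ^ 2 =
        311364 * W ^ 2 * (x ^ (F / 2) * x ^ (F / 2)) * N ^ 4 * S ^ 4 := by ring
    rw [e1, xpow_add hx, show F / 2 + F / 2 = F by ring]
    have : 0 ≤ W ^ 2 * x ^ F * N ^ 4 * S ^ 4 := by positivity
    linarith only [this]
  -- prefactors
  have hNS23 : N ≤ S ^ (2 / 3 : ℝ) := hNS.trans (Real.rpow_le_rpow_of_exponent_le hS1 (by linarith only [hη]))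
  have hNx : N ≤ x ^ (1 / 2 : ℝ) := by
    have h2 : S ^ (2 / 3 : ℝ) ≤ (x ^ (1 / 2 + δ)) ^ (2 / 3 : ℝ) := Real.rpow_le_rpow hS0 hSx' (by norm_num)
    rw [← Real.rpow_mul hx0.le] at h2
    exact hNS23.trans (h2.trans (Real.rpow_le_rpow_of_exponent_le hx (by nlinarith only [hδs, hδ])))
  have hN3w : N ^ 3 ≤ x ^ (3 / 2 : ℝ) := by
    calc N ^ 3 ≤ (x ^ (1 / 2 : ℝ)) ^ 3 := by gcongr
      _ = x ^ (3 / 2 : ℝ) := by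
          rw [← Real.rpow_natCast, ← Real.rpow_mul hx0.le]; norm_num
  have hS2x : S ^ 2 ≤ x ^ (1 + 2 * δ) := by
    have := Real.rpow_le_rpow hS0 hSx' (by norm_num : (0 : ℝ) ≤ 2)
    rw [← Real.rpow_mul hx0.le, show ((1 / 2 + δ) * 2 : ℝ) = 1 + 2 * δ by ring] at this
    calc S ^ 2 = S ^ ((2 : ℕ) : ℝ) := (Real.rpow_natCast S 2).symm
      _ = S ^ (2 : ℝ) := by norm_num
      _ ≤ _ := this
  have hxm1 : x ^ (-1 : ℝ) = x⁻¹ := Real.rpow_neg_one x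
  have hHbx : Hb ≤ 2 * x ^ (1 / 2 + 2 * δ + ε₁) := by
    have t1 : a ≤ x ^ (1 / 2 + 2 * δ + ε₁) := by
      have : a = S ^ 2 * N * x ^ ε₁ * x ^ (-1 : ℝ) := by rw [hadef, hxm1]; ring
      rw [this]
      calc S ^ 2 * N * x ^ ε₁ * x ^ (-1 : ℝ) ≤ x ^ (1 + 2 * δ) * x ^ (1 / 2 : ℝ) * x ^ ε₁ * x ^ (-1 : ℝ) := by
            gcongr
        _ = x ^ (1 / 2 + 2 * δ + ε₁) := by rw [xpow_add hx, xpow_add hx, xpow_add hx]; ring_nf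
    have t2 : (1 : ℝ) ≤ x ^ (1 / 2 + 2 * δ + ε₁) := xp1 _ (by positivity)
    rw [hHb]; linarith only [t1, t2]
  have hP : (q * C * D * Nb * R * S') ^ e ≤ 304 * x ^ (7 / 2 * e) := by
    have hP1 : q * C * D * Nb * R * S' ≤ 304 * x ^ (7 / 2 : ℝ) := by
      calc q * C * D * Nb * R * S' ≤ x ^ θ * (2 * S) * (2 * S) * (38 * x ^ δ * N * Hb) * (x ^ (2 * δ) * N) * (x ^ δ * N) := by
            gcongr
        _ = 152 * (x ^ θ * x ^ δ * x ^ (2 * δ) * x ^ δ) * S ^ 2 * N ^ 3 * Hb := by ring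
        _ ≤ 152 * (x ^ θ * x ^ δ * x ^ (2 * δ) * x ^ δ) * x ^ (1 + 2 * δ) * x ^ (3 / 2 : ℝ) *
              (2 * x ^ (1 / 2 + 2 * δ + ε₁)) := by gcongr
        _ = 304 * (x ^ θ * x ^ δ * x ^ (2 * δ) * x ^ δ * x ^ (1 + 2 * δ) * x ^ (3 / 2 : ℝ) *
              x ^ (1 / 2 + 2 * δ + ε₁)) := by ring
        _ = 304 * x ^ (θ + δ + 2 * δ + δ + (1 + 2 * δ) + 3 / 2 + (1 / 2 + 2 * δ + ε₁)) := by
            rw [xpow_add hx, xpow_add hx, xpow_add hx, xpow_add hx, xpow_add hx, xpow_add hx]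
        _ ≤ 304 * x ^ (7 / 2 : ℝ) := by
            gcongr 304 * ?_
            exact Real.rpow_le_rpow_of_exponent_le hx (by rw [hθ]; linarith only [hδs, hκs, hε₁s])
    have hP0 : 0 ≤ q * C * D * Nb * R * S' := by positivity
    calc (q * C * D * Nb * R * S') ^ e ≤ (304 * x ^ (7 / 2 : ℝ)) ^ e := Real.rpow_le_rpow hP0 hP1 he
      _ = (304 : ℝ) ^ e * x ^ (7 / 2 * e) := by
          rw [Real.mul_rpow (by norm_num) (xp _).le, ← Real.rpow_mul hx0.le]
      _ ≤ 304 * x ^ (7 / 2 * e) := by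
          gcongr
          calc (304 : ℝ) ^ e ≤ (304 : ℝ) ^ (1 : ℝ) := Real.rpow_le_rpow_of_exponent_le (by norm_num) he1
            _ = 304 := Real.rpow_one _
  have hq32 : q ^ (3 / 2 : ℝ) ≤ x ^ (3 / 2 * θ) := by
    calc q ^ (3 / 2 : ℝ) ≤ (x ^ θ) ^ (3 / 2 : ℝ) := Real.rpow_le_rpow hq0 hq (by norm_num)
      _ = x ^ (3 / 2 * θ) := by rw [← Real.rpow_mul hx0.le]; ring_nf
  have hfin : x ^ (7 / 2 * e) * x ^ (3 / 2 * θ) * x ^ (F / 2) ≤ x ^ (-8 * κ) := by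
    rw [xpow_add hx, xpow_add hx]
    refine Real.rpow_le_rpow_of_exponent_le hx ?_
    rw [hF, hθ]
    linarith only [hexp]
  calc A * (q * C * D * Nb * R * S') ^ e * q ^ (3 / 2 : ℝ) *
        Real.sqrt (q ^ 2 * (C * S' * (R * S' + Nb) * (C + R * D) + S' * Nb * R) * Sb +
          q * (C ^ 2 * D * S' * Real.sqrt (R * (R * S' + Nb)) + D ^ 2 * Nb * R) * Sb)
      ≤ A * (304 * x ^ (7 / 2 * e)) * x ^ (3 / 2 * θ) * (558 * W * x ^ (F / 2) * N ^ 2 * S ^ 2) := by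
        gcongr
    _ = 169632 * A * W * N ^ 2 * S ^ 2 * (x ^ (7 / 2 * e) * x ^ (3 / 2 * θ) * x ^ (F / 2)) := by ring
    _ ≤ 169632 * A * W * N ^ 2 * S ^ 2 * x ^ (-8 * κ) := by gcongr

end Main

end Drappeau2017

end Literature.NumberTheory.Sieve

end
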